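import Literature.MathematicalPhysics.QuantumFieldTheory.Balaban1983to89.Beta.MomentFactorisation

/-!
# Beta/DecimatedMoment — two-sided, non-commutative windowed moments of a dressed kernel (an2 item 11)

HONEST FRAMING (cell `pub-balaban`, β sub-cell, row BETA-an2, node BETA-an2-DECIMATED-MOMENT).  The β sub-cell
tries to discharge the one-loop input `BetaPertH` of [Balaban1987RG1] Theorem 2; discharging it would make
Bałaban's ultraviolet STABILITY theorem unconditional — a real constructive-QFT result, but NOT the continuum limit
and NOT the Clay Millennium problem.  This file is far less than that: an ELEMENTARY ALGEBRAIC IDENTITY for finite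
sums over a lattice with values in an arbitrary (non-commutative) ring.  Value = kernel certificate of one structural
step, NOT summit progress.  ABSOLUTE RULE of the cell: nothing of the manuscripts under audit is used as a fact; the
Bałaban references below are CONTEXT LOCATORS only; every theorem here is [folklore]-level finite algebra.

CONTEXT (why the cell wants this; nothing of it is asserted in Lean).  [Balaban1987RG1] p. 264 (1.20)–(1.22) defines
the coefficient `β_{j+1}` as the second moment `Σ_x Π_{j+1,μν}(x) x_μ x_ν` (printed «for μ, ν arbitrary, μ ≠ ν») of
the Hessian at zero of an effective-action term COMPOSED with the background-field map `B ↦ U_{j+1}(exp iB)`; p. 260 (1.3) carries the order-zero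
terms `log Z^{(j)}(U_k) − log Z^{(j)}(1)` from step to step as FIXED functionals re-evaluated at the current background,
and p. 270 (3.3) composes the background maps, `U_k = U_j ∘ Ū^j_k`.  Differentiating a carried term twice through a
translation-COVARIANT linear coarse→fine map with LEFT response pattern `w` and RIGHT response pattern `w'` (for
one-forms the two differ: `u ↦ w(u)ᵀ` versus `w`, matrix-valued in direction ⊗ colour) turns the fine Hessian kernel `T`
into the coarse kernel `Y ↦ Σ_{u,x} w(u) · T(LY + u − x) · w'(x)`, whose second moment in fine units is the WINDOWED sum
`Σ_{u,t,x} χ(t + x − u) · (t + x − u)_κ (t + x − u)_λ • (w u · T t · w' x)` with `χ` the indicator of the sublattice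
`L•ℤ^d` (the coarse point is `LY = t + x − u`).  The question «does the marginal coefficient of a carried term change
from scale to scale?» ([Balaban1987RG1] p. 292 l. 7–9 asserts the cancellation of the marginal parts; the cell's
`Beta/MarginalTelescoping.IdentityForm`) is therefore a question about windowed second moments of two-sided dressed
kernels.  The scalar, commutative, same-weight case is the Strang–Fix / Poisson-summation identity of the companion
module `Beta/StrangFixMoment` (unit b2b-balaban-b12-g9, record `HOME/b2b-balaban-b12-g9/B12-XREAD-V22.md` §3):
affine reproduction by the response pattern (Strang–Fix conditions of order 1, [Buhmann2003] §4.2 (4.16)–(4.18)) and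
`Σ T = 0` give «decimated second moment = undressed second moment × mass», with NO condition on the first moment of
`T`.  THIS FILE does the ONE-FORM-shaped case the scalar theorem does not cover: two DIFFERENT weights, values in ANY
ring `R` (matrix patterns), windowed-moment constants `σ`, `C_κ`, `σ'` that are arbitrary, possibly NON-CENTRAL ring
elements — and shows that then the vanishing FIRST moment of `T` is a genuine additional hypothesis (witness below).

WHAT THIS FILE PROVES (all [folklore]; `R` any `Ring`; lattice `X = Fin d → ℤ`; `χ : X → ℤ` an ARBITRARY integer window
— the indicator of `L•ℤ^d` gives decimated moments, `χ ≡ 1` gives the full moments of `Beta/MomentFactorisation`; finite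
index sets `Sw ∋ u`, `ST ∋ t`, `Sx ∋ x`; `wsum χ Sw ST Sx w T w' g = Σ_u Σ_t Σ_x (χ(t+x−u) · g u t x) • (w u · T t · w' x)`;
finite moments `fmom S a f = Σ_{y∈S} a y • f y`).  HYPOTHESES (windowed moments; for the sublattice indicator these are
COSET sums, i.e. exact reproduction of constants and of the coordinate functions by the left pattern, of constants by
the right pattern):
  (L0) `∀ a, Σ_{u∈Sw} χ(a − u) • w u = σ`,   (L1) `∀ a κ, Σ_{u∈Sw} (χ(a − u) · u_κ) • w u = C κ`,
  (R0) `∀ a, Σ_{x∈Sx} χ(x − a) • w' x = σ'`.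
* `wsum_master_nine` — under (L0), (L1), (R0) and NO hypothesis on `T`, the windowed second moment
  `wsum χ … (fun u t x => (t+x−u)_κ (t+x−u)_λ)` EQUALS the nine displayed terms
  `σ·M2_{κλ}(T)·M0(w') + σ·M1_κ(T)·M1_λ(w') + σ·M1_λ(T)·M1_κ(w') − C_λ·M1_κ(T)·M0(w') − C_κ·M1_λ(T)·M0(w')`
  `+ σ·M0(T)·M2_{κλ}(w') − C_λ·M0(T)·M1_κ(w') − C_κ·M0(T)·M1_λ(w') + M2_{κλ}(w)·M0(T)·σ'`
  (moments of `T`, `w'`, `w` as finite sums over `ST`, `Sx`, `Sw`; factor ORDER as written);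
* `wsum_second_of_vanishing` — if moreover (T0) `Σ_t T t = 0` and (T1) `Σ_t t_κ • T t = 0`, `Σ_t t_λ • T t = 0`, the
  windowed second moment is `σ · M2_{κλ}(T) · M0(w')` EXACTLY (the `IdentityForm` germ: dressing-and-decimation does
  not change the second moment, up to the mass factors `σ` and `M0(w')`);
* `wsum_zero_master`, `wsum_first_master` and `wsum_zero_of_vanishing`, `wsum_first_of_vanishing` — the windowed
  zeroth and first moments: `σ·M0(T)·M0(w')` resp. `σ·M1_κ(T)·M0(w') + σ·M0(T)·M1_κ(w') − C_κ·M0(T)·M0(w')`, hence ZERO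
  under (T0), (T1): the coarse kernel again satisfies (T0), (T1), so the identity ITERATES along a composition chain;
* §4, kernel WITNESSES over `ℤ`, `d = 1`, window = indicator of `2ℤ` (by `decide`):
  `witness_L1_needed` — left = right = the block-constant pattern `1_{{0,1}}` ((L0), (R0) hold with `σ = σ' = 1`, (L1)
  FAILS), `T = δ₋₁ − 2δ₀ + δ₁` ((T0), (T1) hold, `M2 T = 2`): windowed second moment `8 ≠ 4 = σ·M2(T)·M0(w')` — affine
  (not merely constant) reproduction is NECESSARY; `witness_T1_needed` — left = `δ₋₁ + 2δ₀ + δ₁` ((L0), (L1) with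
  `σ = 2`, `C = 0`), right = `1_{{0,1}}` ((R0), `σ' = 1`), `T = δ₁ − δ₀` ((T0) holds, (T1) FAILS): `8 ≠ 4` — in the
  two-sided setting the first-moment condition on `T` cannot be dropped IN GENERAL (by the master identity it is
  not needed when `C = 0` and the right pattern is centred, `M1(w') = 0`; in the same-weight commutative setting of
  `Beta/StrangFixMoment` it drops altogether); `example_identity` — left = right = `δ₋₁ + 2δ₀ + δ₁`, `T = δ₋₁ − 2δ₀ + δ₁`: `16 = 16`.
  The hypotheses of the witnesses are certified for EVERY coset representative `a` (`blockConst_L0`, `blockConst_R0`,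
  `hat_L0`, `hat_L1`, `hat_R0`) and the failure of (L1) for the block-constant pattern as `blockConst_L1_fails`.
* §5, the dictionary to `Beta/MomentFactorisation` (`LatFun d R = (Fin d → ℤ) →₀ R`, `conv`, `reflect`, `moment`, `M0`,
  `M1`, `M2`): `moment φ f = fmom f.support φ ⇑f`; `moment_conv3` / `moment_dressed_eq_sum` — the `ψ`-moment of the
  two-sided dressed kernel `reflect w ⋆ T ⋆ w' = conv (conv (reflect w) T) w'` is the triple sum
  `Σ_{u,t,x} ψ(t + x − u) • (w u · T t · w' x)` over the supports, so `wsum χ … (φ(t+x−u)) = moment (χ·φ) (reflect w ⋆ T ⋆ w')`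
  (`wsum_eq_moment`); hence `windowed_second_moment_dressed` — under (L0), (L1), (R0) over the supports and `M0 T = 0`,
  `M1_κ T = M1_λ T = 0`: `moment (χ · y_κ y_λ) (reflect w ⋆ T ⋆ w') = σ · M2_{κλ} T · M0 w'` for ANY window `χ` — and
  `windowed_low_moments_dressed` (the `χ`-windowed zeroth and first moments of the dressed kernel vanish).
* §6 (v1.1), WHERE (T0), (T1) COME FROM at the typed level: for any finitely supported family of kernels
  `K μ ν : LatFun d R` — `M0_eq_zero_of_divFree`: divergence-freeness in the first index (backward differences,
  `Σ_μ (K_{μν}(z) − K_{μν}(z − e_μ)) = 0` as lattice functions) forces EVERY zeroth moment `M0 (K κ ν)` to vanish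
  (take a first moment of the identity); `M1_add_self_eq_zero_of_inversion` / `M1_eq_zero_of_inversion`: evenness
  about a midpoint offset, `K(c − z) = K(z)`, together with `M0 K = 0` forces `M1_κ K + M1_κ K = 0`, i.e. `M1_κ K = 0`
  without 2-torsion; packaged as `low_moments_of_symmetries` ((T0) ∧ (T1) entrywise).  Helpers `relabel`
  (= `Finsupp.mapDomain`), `unitVec`, `moment_relabel`, `M0_relabel`, `moment_const`, `M1_shift`, `M1_invert`,
  `moment_finset_sum`.  CONTEXT: these two position-space symmetries are the shapes PRINTED for the one-loop
  vacuum-polarization kernel in [Balaban1987RG1] §5 — p. 293 (5.7) with `ε ≡ −1` and (5.8) (inversion about the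
  bond midpoint, from the Euclidean invariance (5.2) p. 292) and p. 293 (5.9) («the gauge invariance, expressed in
  the first identity (4.15), implies Σ_μ ∂*_μ Π_{μν}(x − y) = 0») — read on the page renders; locators only, the
  infinite-volume decaying kernel of (5.10) is NOT a `Finsupp` and the passage to it is not treated here.
* §7 (v1.2), THE ONE-STEP HYPOTHESES ITERATE: for the sublattice window `cosetInd N` (indicator of `N•ℤ^d`) the
  reproduction conditions `ConstRepro N w σ` (= (L0)/(R0): every coset sum of `w` is `σ`) and `LinRepro N w C`
  (= (L1): every coset first moment is `C κ`) are PRESERVED UNDER COMPOSITION of covariant maps —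
  `constRepro_comp` / `linRepro_comp`: if `w₁` reproduces for `N₁•ℤ^d` (`σ₁`, `C₁`) and `w₂` for `N₂•ℤ^d` (`σ₂`, `C₂`),
  the composite pattern `w₁ ⋆ dilate N₁ w₂` reproduces for `N₁N₂•ℤ^d` with `σ = σ₁σ₂` and
  `C κ = C₁ κ · σ₂ + N₁ • (σ₁ · C₂ κ)` (key arithmetic step `cosetInd_sub_dilate`: on `c − N₁•y` the window of
  `N₁N₂•ℤ^d` factors as `cosetInd N₁ c · cosetInd N₂ (c/N₁ − y)`); by induction `constRepro_iter` / `linRepro_iter`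
  for the `m`-fold composite `iterPattern L w m` (window `L^m•ℤ^d`, mass `σ^m`, constants `iterC L σ C m`), and
  `windowed_second_moment_iter`: the §5 identity for the `m`-fold composite dressing FROM THE ONE-STEP HYPOTHESES
  (L0), (L1) alone — so the analytic input «the linearised background map reproduces affine one-forms» is needed for
  ONE renormalization step only.  Bridges `constRepro_iff`, `linRepro_iff`, `constRepro_iff_right` to the §5 form.

HOW IT IS MEANT TO BE USED (row file `HOME/BETA/AN2.md` §11; nothing of it is asserted here).  With `T` = the Hessian
at the trivial configuration of a carried order-zero term composed with the j-fold background map (zero-momentum Ward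
identity (T0) = the cell's Lemma W `Beta/WardIdentity` / [Balaban1987RG1] (4.15)₁ p. 284, at the typed level §6
`M0_eq_zero_of_divFree`; (T1) from inversion covariance (5.7)–(5.8) p. 293, at the typed level §6
`M1_eq_zero_of_inversion`; criticality (4.14) kills the second chain-rule term) and `w`, `w'` = the gauge-corrected
response patterns of the linearised (k−j)-fold background map (affine reproduction modulo linearised gauge, reduced to
exact reproduction because `T` annihilates exact one-forms on both sides), `wsum_second_of_vanishing` says that the
(1.22)-moment of the carried term at scale `k` is `N^{d−4}` times its value at scale `j` (`N = L^{k−j}`; `σ = N⁻¹` per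
bond, `M0(w') = N^d σ'`, moments in coarse units `N⁻²`), i.e. UNCHANGED in `d = 4`: `MarginalTelescoping.IdentityForm`,
`SeparationRate` with constant `0`.  WHAT THIS FILE DOES NOT DO: identify `w`, `T`, `w'` with Bałaban's operators
(in particular the affine-reproduction property of the linearised ONE-STEP background map — row file §11 (I7)
(AFF-lin), an [analysis] input resting on the uniqueness of the constrained minimizer — is NOT proved here); the
definition of the coefficient through the infinite-volume limit `T ↗ ℤ⁴` of (5.1)/(1.22) and kernels of infinite
support (extension by dominated convergence under the printed decay (5.10)); the identification of the carried
coefficients with the printed `β`/`B(L^k)` including the per-step gauge-fixing normalisations; the replacement /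
localisation terms of [Balaban1987RG1] §4 (located at (4.34)–(4.44) pp. 289–292 and (5.43) — LOCATION only, no bound
of theirs is used or asserted); the gauge correction; anything at order `g`.

References (context locators only): T. Bałaban, Commun. Math. Phys. 109 (1987) 249–301 [Balaban1987RG1] ((1.3) p. 260,
(1.20)–(1.22) p. 264, (3.3) p. 270, (4.14)–(4.15) p. 284, p. 292 l. 7–9, (5.1)–(5.6) p. 292, (5.7)–(5.10) p. 293);
M. D. Buhmann, Radial Basis Functions, CUP 2003
[Buhmann2003] §4.2 (Strang–Fix conditions); companion modules `Beta/MomentFactorisation` (an2 item 8),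
`Beta/StrangFixMoment` (b2b-balaban-b12-g9), `Beta/MarginalTelescoping` (pv28).  Unit `b2b-balaban-beta-an2-g4`
(β sub-cell, an2 lineage gen 4); v1.0 p181561 (§1–§5) → v1.1 p181610 (APPEND-ONLY: §6) → v1.2 (APPEND-ONLY: §7;
§1–§6 code byte-identical; header amended per the cross-read GAPS X-an2-24 (A1)–(A3)).
NOT summit progress; NOT continuum, NOT Clay.
-/

namespace Literature.MathematicalPhysics.QuantumFieldTheory.Balaban1983to89.Beta.DecimatedMoment

open Finset

variable {d : ℕ} {R : Type*} [Ring R]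

/-! ## §1 Windowed dressed sums and finite moments -/

/-- Finite moment with integer weight `a` over the index set `S`: `Σ_{y∈S} a y • f y`. [folklore] -/
def fmom (S : Finset (Fin d → ℤ)) (a : (Fin d → ℤ) → ℤ) (f : (Fin d → ℤ) → R) : R :=
  ∑ y ∈ S, a y • f y

/-- The windowed two-sided dressed sum with integer weight `g u t x` and window `χ` evaluated at the coarse point
`t + x − u`: `Σ_{u∈Sw} Σ_{t∈ST} Σ_{x∈Sx} (χ(t+x−u) · g u t x) • (w u · T t · w' x)`. [folklore] -/
def wsum (χ : (Fin d → ℤ) → ℤ) (Sw ST Sx : Finset (Fin d → ℤ)) (w T w' : (Fin d → ℤ) → R)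
    (g : (Fin d → ℤ) → (Fin d → ℤ) → (Fin d → ℤ) → ℤ) : R :=
  ∑ u ∈ Sw, ∑ t ∈ ST, ∑ x ∈ Sx, (χ (t + x - u) * g u t x) • (w u * T t * w' x)

section Algebra

variable (χ : (Fin d → ℤ) → ℤ) (Sw ST Sx : Finset (Fin d → ℤ)) (w T w' : (Fin d → ℤ) → R)

/-- `wsum` is additive in the integer weight. [folklore] -/
theorem wsum_add (g h : (Fin d → ℤ) → (Fin d → ℤ) → (Fin d → ℤ) → ℤ) :
    wsum χ Sw ST Sx w T w' (fun u t x => g u t x + h u t x)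
      = wsum χ Sw ST Sx w T w' g + wsum χ Sw ST Sx w T w' h := by
  simp only [wsum, mul_add, add_smul, Finset.sum_add_distrib]

/-- `wsum` is subtractive in the integer weight. [folklore] -/
theorem wsum_sub (g h : (Fin d → ℤ) → (Fin d → ℤ) → (Fin d → ℤ) → ℤ) :
    wsum χ Sw ST Sx w T w' (fun u t x => g u t x - h u t x)
      = wsum χ Sw ST Sx w T w' g - wsum χ Sw ST Sx w T w' h := by
  simp only [wsum, mul_sub, sub_smul, Finset.sum_sub_distrib]

/-- Scalar bookkeeping: `(c · g) • (a · b · e) = g • ((c • a) · b · e)`. [folklore] -/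
theorem smul_pull_left (c g : ℤ) (a b e : R) : (c * g) • (a * b * e) = g • (c • a * b * e) := by
  rw [mul_comm, ← smul_smul, smul_mul_assoc, smul_mul_assoc]

/-- Scalar bookkeeping: `(c · g) • (a · b · e) = g • (a · b · (c • e))`. [folklore] -/
theorem smul_pull_right (c g : ℤ) (a b e : R) : (c * g) • (a * b * e) = g • (a * b * (c • e)) := by
  rw [mul_comm, ← smul_smul, mul_smul_comm]

/-! ## §2 Collapsing one index with a windowed-moment hypothesis -/

/-- LEFT collapse, order 0: under (L0) a weight not depending on `u` collapses the `u`-sum to `σ`. [folklore] -/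
theorem wsum_collapse_left0 {σ : R} (hL0 : ∀ a, ∑ u ∈ Sw, χ (a - u) • w u = σ)
    (c : (Fin d → ℤ) → (Fin d → ℤ) → ℤ) :
    wsum χ Sw ST Sx w T w' (fun _ t x => c t x) = ∑ t ∈ ST, ∑ x ∈ Sx, c t x • (σ * T t * w' x) := by
  simp only [wsum]
  rw [Finset.sum_comm]
  refine Finset.sum_congr rfl fun t _ => ?_
  rw [Finset.sum_comm]
  refine Finset.sum_congr rfl fun x _ => ?_
  rw [← hL0 (t + x), Finset.sum_mul, Finset.sum_mul, Finset.smul_sum]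
  refine Finset.sum_congr rfl fun u _ => ?_
  rw [smul_pull_left]

/-- LEFT collapse, order 1: under (L1) a weight `u_κ · c t x` collapses the `u`-sum to `C κ`. [folklore] -/
theorem wsum_collapse_left1 {C : Fin d → R} (hL1 : ∀ a κ, ∑ u ∈ Sw, (χ (a - u) * u κ) • w u = C κ)
    (κ : Fin d) (c : (Fin d → ℤ) → (Fin d → ℤ) → ℤ) :
    wsum χ Sw ST Sx w T w' (fun u t x => u κ * c t x) = ∑ t ∈ ST, ∑ x ∈ Sx, c t x • (C κ * T t * w' x) := by
  simp only [wsum]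
  rw [Finset.sum_comm]
  refine Finset.sum_congr rfl fun t _ => ?_
  rw [Finset.sum_comm]
  refine Finset.sum_congr rfl fun x _ => ?_
  rw [← hL1 (t + x) κ, Finset.sum_mul, Finset.sum_mul, Finset.smul_sum]
  refine Finset.sum_congr rfl fun u _ => ?_
  rw [← mul_assoc, smul_pull_left]

/-- RIGHT collapse, order 0: under (R0) a weight not depending on `x` collapses the `x`-sum to `σ'`. [folklore] -/
theorem wsum_collapse_right0 {σ' : R} (hR0 : ∀ a, ∑ x ∈ Sx, χ (x - a) • w' x = σ')
    (c : (Fin d → ℤ) → (Fin d → ℤ) → ℤ) :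
    wsum χ Sw ST Sx w T w' (fun u t _ => c u t) = ∑ u ∈ Sw, ∑ t ∈ ST, c u t • (w u * T t * σ') := by
  simp only [wsum]
  refine Finset.sum_congr rfl fun u _ => ?_
  refine Finset.sum_congr rfl fun t _ => ?_
  rw [← hR0 (u - t), Finset.mul_sum, Finset.smul_sum]
  refine Finset.sum_congr rfl fun x _ => ?_
  rw [show t + x - u = x - (u - t) by abel, smul_pull_right]

/-- Bilinear factorisation on the right of `σ`: `Σ_{t,x} (a t · b x) • (σ · T t · w' x) = σ · (Σ a•T) · (Σ b•w')`.
[folklore] -/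
theorem sum_factor_left (σ : R) (a b : (Fin d → ℤ) → ℤ) :
    ∑ t ∈ ST, ∑ x ∈ Sx, (a t * b x) • (σ * T t * w' x) = σ * fmom ST a T * fmom Sx b w' := by
  calc ∑ t ∈ ST, ∑ x ∈ Sx, (a t * b x) • (σ * T t * w' x)
      = ∑ t ∈ ST, (a t • (σ * T t)) * ∑ x ∈ Sx, b x • w' x := by
        refine Finset.sum_congr rfl fun t _ => ?_
        rw [Finset.mul_sum Sx _ (a t • (σ * T t))]
        refine Finset.sum_congr rfl fun x _ => ?_
        simp only [smul_mul_assoc, mul_smul_comm, smul_smul, mul_comm (b x) (a t)]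
    _ = (∑ t ∈ ST, a t • (σ * T t)) * ∑ x ∈ Sx, b x • w' x := by rw [Finset.sum_mul]
    _ = σ * fmom ST a T * fmom Sx b w' := by
        simp only [fmom]
        congr 1
        rw [Finset.mul_sum ST _ σ]
        refine Finset.sum_congr rfl fun t _ => ?_
        rw [mul_smul_comm]

/-- Bilinear factorisation on the left of `σ'`: `Σ_{u,t} (a u · b t) • (w u · T t · σ') = (Σ a•w) · (Σ b•T) · σ'`.
[folklore] -/
theorem sum_factor_right (σ' : R) (a b : (Fin d → ℤ) → ℤ) :
    ∑ u ∈ Sw, ∑ t ∈ ST, (a u * b t) • (w u * T t * σ') = fmom Sw a w * fmom ST b T * σ' := by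
  calc ∑ u ∈ Sw, ∑ t ∈ ST, (a u * b t) • (w u * T t * σ')
      = ∑ u ∈ Sw, (a u • w u) * (∑ t ∈ ST, b t • T t) * σ' := by
        refine Finset.sum_congr rfl fun u _ => ?_
        rw [Finset.mul_sum ST _ (a u • w u), Finset.sum_mul]
        refine Finset.sum_congr rfl fun t _ => ?_
        simp only [smul_mul_assoc, mul_smul_comm, smul_smul, mul_comm (b t) (a u)]
    _ = fmom Sw a w * fmom ST b T * σ' := by
        simp only [fmom]
        rw [Finset.sum_mul, Finset.sum_mul]

/-! ## §3 The three monomial types and the master identities -/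

/-- Type (t,x): a weight `a t · b x` gives `σ · fmom a T · fmom b w'` under (L0). [folklore] -/
theorem wsum_type_tx {σ : R} (hL0 : ∀ a, ∑ u ∈ Sw, χ (a - u) • w u = σ) (a b : (Fin d → ℤ) → ℤ) :
    wsum χ Sw ST Sx w T w' (fun _ t x => a t * b x) = σ * fmom ST a T * fmom Sx b w' := by
  rw [wsum_collapse_left0 χ Sw ST Sx w T w' hL0 (fun t x => a t * b x)]
  exact sum_factor_left ST Sx T w' σ a b

/-- Type (u_κ;t,x): a weight `u_κ · (a t · b x)` gives `C κ · fmom a T · fmom b w'` under (L1). [folklore] -/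
theorem wsum_type_utx {C : Fin d → R} (hL1 : ∀ a κ, ∑ u ∈ Sw, (χ (a - u) * u κ) • w u = C κ) (κ : Fin d)
    (a b : (Fin d → ℤ) → ℤ) :
    wsum χ Sw ST Sx w T w' (fun u t x => u κ * (a t * b x)) = C κ * fmom ST a T * fmom Sx b w' := by
  rw [wsum_collapse_left1 χ Sw ST Sx w T w' hL1 κ (fun t x => a t * b x)]
  exact sum_factor_left ST Sx T w' (C κ) a b

/-- Type (u,t): a weight `a u · b t` gives `fmom a w · fmom b T · σ'` under (R0). [folklore] -/
theorem wsum_type_ut {σ' : R} (hR0 : ∀ a, ∑ x ∈ Sx, χ (x - a) • w' x = σ') (a b : (Fin d → ℤ) → ℤ) :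
    wsum χ Sw ST Sx w T w' (fun u t _ => a u * b t) = fmom Sw a w * fmom ST b T * σ' := by
  rw [wsum_collapse_right0 χ Sw ST Sx w T w' hR0 (fun u t => a u * b t)]
  exact sum_factor_right Sw ST w T σ' a b

/-- **Windowed ZEROTH moment** (master form, (L0) only): `Σ χ • (w·T·w') = σ · M0(T) · M0(w')`. [folklore] -/
theorem wsum_zero_master {σ : R} (hL0 : ∀ a, ∑ u ∈ Sw, χ (a - u) • w u = σ) :
    wsum χ Sw ST Sx w T w' (fun _ _ _ => 1)
      = σ * fmom ST (fun _ => 1) T * fmom Sx (fun _ => 1) w' := by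
  have h := wsum_type_tx χ Sw ST Sx w T w' hL0 (fun _ => 1) (fun _ => 1)
  simpa only [mul_one] using h

/-- **Windowed FIRST moment** (master form, (L0) and (L1)):
`Σ χ·(t+x−u)_κ • (w·T·w') = σ·M1_κ(T)·M0(w') + σ·M0(T)·M1_κ(w') − C_κ·M0(T)·M0(w')`. [folklore] -/
theorem wsum_first_master {σ : R} {C : Fin d → R} (hL0 : ∀ a, ∑ u ∈ Sw, χ (a - u) • w u = σ)
    (hL1 : ∀ a κ, ∑ u ∈ Sw, (χ (a - u) * u κ) • w u = C κ) (κ : Fin d) :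
    wsum χ Sw ST Sx w T w' (fun u t x => (t + x - u) κ)
      = σ * fmom ST (fun t => t κ) T * fmom Sx (fun _ => 1) w'
        + σ * fmom ST (fun _ => 1) T * fmom Sx (fun x => x κ) w'
        - C κ * fmom ST (fun _ => 1) T * fmom Sx (fun _ => 1) w' := by
  have expand : (fun u t x : Fin d → ℤ => (t + x - u) κ)
      = fun u t x => ((t κ * 1 + 1 * x κ) - u κ * (1 * 1)) := by
    funext u t x; simp only [Pi.add_apply, Pi.sub_apply]; ring
  rw [expand, wsum_sub, wsum_add,
    wsum_type_tx χ Sw ST Sx w T w' hL0 (fun t => t κ) (fun _ => 1),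
    wsum_type_tx χ Sw ST Sx w T w' hL0 (fun _ => 1) (fun x => x κ),
    wsum_type_utx χ Sw ST Sx w T w' hL1 κ (fun _ => 1) (fun _ => 1)]

/-- **Windowed SECOND moment — the nine-term MASTER IDENTITY** ((L0), (L1), (R0); NO hypothesis on `T`):
`Σ χ·(t+x−u)_κ(t+x−u)_λ • (w·T·w') = σ·M2_{κλ}(T)·M0(w') + σ·M1_κ(T)·M1_λ(w') + σ·M1_λ(T)·M1_κ(w')`
`− C_λ·M1_κ(T)·M0(w') − C_κ·M1_λ(T)·M0(w') + σ·M0(T)·M2_{κλ}(w') − C_λ·M0(T)·M1_κ(w') − C_κ·M0(T)·M1_λ(w')`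
`+ M2_{κλ}(w)·M0(T)·σ'`. [folklore] -/
theorem wsum_master_nine {σ σ' : R} {C : Fin d → R} (hL0 : ∀ a, ∑ u ∈ Sw, χ (a - u) • w u = σ)
    (hL1 : ∀ a κ, ∑ u ∈ Sw, (χ (a - u) * u κ) • w u = C κ)
    (hR0 : ∀ a, ∑ x ∈ Sx, χ (x - a) • w' x = σ') (κ l : Fin d) :
    wsum χ Sw ST Sx w T w' (fun u t x => (t + x - u) κ * (t + x - u) l)
      = σ * fmom ST (fun t => t κ * t l) T * fmom Sx (fun _ => 1) w'
        + σ * fmom ST (fun t => t κ) T * fmom Sx (fun x => x l) w'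
        + σ * fmom ST (fun t => t l) T * fmom Sx (fun x => x κ) w'
        - C l * fmom ST (fun t => t κ) T * fmom Sx (fun _ => 1) w'
        - C κ * fmom ST (fun t => t l) T * fmom Sx (fun _ => 1) w'
        + σ * fmom ST (fun _ => 1) T * fmom Sx (fun x => x κ * x l) w'
        - C l * fmom ST (fun _ => 1) T * fmom Sx (fun x => x κ) w'
        - C κ * fmom ST (fun _ => 1) T * fmom Sx (fun x => x l) w'
        + fmom Sw (fun u => u κ * u l) w * fmom ST (fun _ => 1) T * σ' := by
  have expand : (fun u t x : Fin d → ℤ => (t + x - u) κ * (t + x - u) l)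
      = fun u t x =>
          ((t κ * t l) * 1 + t κ * x l + t l * x κ
            - u l * (t κ * 1) - u κ * (t l * 1)
            + 1 * (x κ * x l) - u l * (1 * x κ) - u κ * (1 * x l)
            + (u κ * u l) * 1) := by
    funext u t x; simp only [Pi.add_apply, Pi.sub_apply]; ring
  rw [expand]
  rw [wsum_add, wsum_sub, wsum_sub, wsum_add, wsum_sub, wsum_sub, wsum_add, wsum_add,
    wsum_type_tx χ Sw ST Sx w T w' hL0 (fun t => t κ * t l) (fun _ => 1),
    wsum_type_tx χ Sw ST Sx w T w' hL0 (fun t => t κ) (fun x => x l),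
    wsum_type_tx χ Sw ST Sx w T w' hL0 (fun t => t l) (fun x => x κ),
    wsum_type_utx χ Sw ST Sx w T w' hL1 l (fun t => t κ) (fun _ => 1),
    wsum_type_utx χ Sw ST Sx w T w' hL1 κ (fun t => t l) (fun _ => 1),
    wsum_type_tx χ Sw ST Sx w T w' hL0 (fun _ => 1) (fun x => x κ * x l),
    wsum_type_utx χ Sw ST Sx w T w' hL1 l (fun _ => 1) (fun x => x κ),
    wsum_type_utx χ Sw ST Sx w T w' hL1 κ (fun _ => 1) (fun x => x l),
    wsum_type_ut χ Sw ST Sx w T w' hR0 (fun u => u κ * u l) (fun _ => 1)]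

/-- **Windowed zeroth moment vanishes** under (L0) and (T0) `Σ T = 0`. [folklore] -/
theorem wsum_zero_of_vanishing {σ : R} (hL0 : ∀ a, ∑ u ∈ Sw, χ (a - u) • w u = σ)
    (hT0 : fmom ST (fun _ => 1) T = 0) :
    wsum χ Sw ST Sx w T w' (fun _ _ _ => 1) = 0 := by
  rw [wsum_zero_master χ Sw ST Sx w T w' hL0, hT0, mul_zero, zero_mul]

/-- **Windowed first moment vanishes** under (L0), (L1), (T0) and (T1)_κ `Σ t_κ • T t = 0`: the coarse kernel
inherits the vanishing first moment. [folklore] -/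
theorem wsum_first_of_vanishing {σ : R} {C : Fin d → R} (hL0 : ∀ a, ∑ u ∈ Sw, χ (a - u) • w u = σ)
    (hL1 : ∀ a κ, ∑ u ∈ Sw, (χ (a - u) * u κ) • w u = C κ) (κ : Fin d)
    (hT0 : fmom ST (fun _ => 1) T = 0) (hT1 : fmom ST (fun t => t κ) T = 0) :
    wsum χ Sw ST Sx w T w' (fun u t x => (t + x - u) κ) = 0 := by
  rw [wsum_first_master χ Sw ST Sx w T w' hL0 hL1 κ, hT0, hT1]
  simp only [mul_zero, zero_mul, add_zero, sub_zero]

/-- **THE IDENTITY** (two-sided, non-commutative): under (L0), (L1), (R0), (T0) and (T1) for both indices, the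
windowed second moment of the dressed kernel is `σ · M2_{κλ}(T) · M0(w')` — dressing-and-decimation does not change
the second moment, up to the mass factors. [folklore] -/
theorem wsum_second_of_vanishing {σ σ' : R} {C : Fin d → R} (hL0 : ∀ a, ∑ u ∈ Sw, χ (a - u) • w u = σ)
    (hL1 : ∀ a κ, ∑ u ∈ Sw, (χ (a - u) * u κ) • w u = C κ)
    (hR0 : ∀ a, ∑ x ∈ Sx, χ (x - a) • w' x = σ') (κ l : Fin d)
    (hT0 : fmom ST (fun _ => 1) T = 0) (hT1κ : fmom ST (fun t => t κ) T = 0)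
    (hT1l : fmom ST (fun t => t l) T = 0) :
    wsum χ Sw ST Sx w T w' (fun u t x => (t + x - u) κ * (t + x - u) l)
      = σ * fmom ST (fun t => t κ * t l) T * fmom Sx (fun _ => 1) w' := by
  rw [wsum_master_nine χ Sw ST Sx w T w' hL0 hL1 hR0 κ l, hT0, hT1κ, hT1l]
  simp only [mul_zero, zero_mul, add_zero, sub_zero]

/-- The same-index case `κ = λ` needs (T1) for one index only (recorded for convenience). [folklore] -/
theorem wsum_second_diag_of_vanishing {σ σ' : R} {C : Fin d → R} (hL0 : ∀ a, ∑ u ∈ Sw, χ (a - u) • w u = σ)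
    (hL1 : ∀ a κ, ∑ u ∈ Sw, (χ (a - u) * u κ) • w u = C κ)
    (hR0 : ∀ a, ∑ x ∈ Sx, χ (x - a) • w' x = σ') (κ : Fin d)
    (hT0 : fmom ST (fun _ => 1) T = 0) (hT1 : fmom ST (fun t => t κ) T = 0) :
    wsum χ Sw ST Sx w T w' (fun u t x => (t + x - u) κ * (t + x - u) κ)
      = σ * fmom ST (fun t => t κ * t κ) T * fmom Sx (fun _ => 1) w' :=
  wsum_second_of_vanishing χ Sw ST Sx w T w' hL0 hL1 hR0 κ κ hT0 hT1 hT1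

end Algebra

/-! ## §4 Kernel witnesses (`d = 1`, window = indicator of `2ℤ`, values in `ℤ`)

The three hypotheses on the weights and the two on `T` are not decorative: dropping (L1) (constant reproduction only —
the block-constant injection) or dropping (T1) in the two-sided setting changes the windowed second moment.  All
numbers are certified by `decide`. -/

section Witness

/-- The one-dimensional site `n`. [folklore] -/
def pt (n : ℤ) : Fin 1 → ℤ := fun _ => n

/-- Window: indicator of the even sublattice `2ℤ` (decimation by `L = 2`). [folklore] -/
def χ₂ (v : Fin 1 → ℤ) : ℤ := if v 0 % 2 = 0 then 1 else 0

/-- The sites `{−1, 0, 1}`. [folklore] -/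
def S₃ : Finset (Fin 1 → ℤ) := {pt (-1), pt 0, pt 1}

/-- Block-constant injection pattern `1_{{0,1}}` (reproduces constants, NOT the coordinate). [folklore] -/
def blockConst (v : Fin 1 → ℤ) : ℤ := if v 0 = 0 ∨ v 0 = 1 then 1 else 0

/-- Hat pattern `δ₋₁ + 2δ₀ + δ₁` (twice the piecewise-linear interpolation weights: reproduces constants with `σ = 2`
and the coordinate with `C = 0`). [folklore] -/
def hat (v : Fin 1 → ℤ) : ℤ := if v 0 = 0 then 2 else if v 0 = 1 ∨ v 0 = -1 then 1 else 0

/-- Lattice Laplacian stencil `δ₋₁ − 2δ₀ + δ₁` (`M0 = 0`, `M1 = 0`, `M2 = 2`). [folklore] -/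
def lap (v : Fin 1 → ℤ) : ℤ := if v 0 = 0 then -2 else if v 0 = 1 ∨ v 0 = -1 then 1 else 0

/-- Forward difference stencil `δ₁ − δ₀` (`M0 = 0`, `M1 = 1 ≠ 0`, `M2 = 1`). [folklore] -/
def grad (v : Fin 1 → ℤ) : ℤ := if v 0 = 0 then -1 else if v 0 = 1 then 1 else 0

/-- A sum over `S₃` is the three-term sum. [folklore] -/
theorem sum_S₃ {M : Type*} [AddCommMonoid M] (f : (Fin 1 → ℤ) → M) :
    ∑ y ∈ S₃, f y = f (pt (-1)) + f (pt 0) + f (pt 1) := by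
  have h1 : pt (-1) ∉ ({pt 0, pt 1} : Finset (Fin 1 → ℤ)) := by decide
  have h2 : pt 0 ∉ ({pt 1} : Finset (Fin 1 → ℤ)) := by decide
  rw [S₃, Finset.sum_insert h1, Finset.sum_insert h2, Finset.sum_singleton, add_assoc]

/-- (L0)/(R0) for the block-constant pattern hold for EVERY coset representative `a`, with `σ = σ' = 1`. [folklore] -/
theorem blockConst_L0 (a : Fin 1 → ℤ) : ∑ u ∈ S₃, χ₂ (a - u) • blockConst u = 1 := by
  rw [sum_S₃]; norm_num [χ₂, blockConst, pt]; split_ifs <;> omega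

/-- (R0) for the block-constant pattern, every `a`, `σ' = 1`. [folklore] -/
theorem blockConst_R0 (a : Fin 1 → ℤ) : ∑ x ∈ S₃, χ₂ (x - a) • blockConst x = 1 := by
  rw [sum_S₃]; norm_num [χ₂, blockConst, pt]; split_ifs <;> omega

/-- (L1) FAILS for the block-constant pattern: the windowed first moment is `0` at `a = 0` and `1` at `a = 1`.
[folklore] -/
theorem blockConst_L1_fails : ¬ ∃ C : ℤ, ∀ a : Fin 1 → ℤ, ∑ u ∈ S₃, (χ₂ (a - u) * u 0) • blockConst u = C := by
  rintro ⟨C, hC⟩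
  have h0 := hC (pt 0)
  have h1 := hC (pt 1)
  have e0 : ∑ u ∈ S₃, (χ₂ (pt 0 - u) * u 0) • blockConst u = 0 := by decide
  have e1 : ∑ u ∈ S₃, (χ₂ (pt 1 - u) * u 0) • blockConst u = 1 := by decide
  omega

/-- (L0), (L1), (R0) for the hat pattern hold for EVERY `a`, with `σ = σ' = 2`, `C = 0`. [folklore] -/
theorem hat_L0 (a : Fin 1 → ℤ) : ∑ u ∈ S₃, χ₂ (a - u) • hat u = 2 := by
  rw [sum_S₃]; norm_num [χ₂, hat, pt]; split_ifs <;> omega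

/-- (L1) for the hat pattern, every `a`, `C = 0`. [folklore] -/
theorem hat_L1 (a : Fin 1 → ℤ) : ∑ u ∈ S₃, (χ₂ (a - u) * u 0) • hat u = 0 := by
  rw [sum_S₃]; norm_num [χ₂, hat, pt]; split_ifs <;> omega

/-- (R0) for the hat pattern, every `a`, `σ' = 2`. [folklore] -/
theorem hat_R0 (a : Fin 1 → ℤ) : ∑ x ∈ S₃, χ₂ (x - a) • hat x = 2 := by
  rw [sum_S₃]; norm_num [χ₂, hat, pt]; split_ifs <;> omega

/-- The hypotheses in the witnesses, certified: block-constant satisfies (L0)/(R0) with `σ = 1` on every coset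
representative in a window, hat satisfies (L0) with `σ = 2` and (L1) with `C = 0`; `lap` has moments `0, 0, 2`,
`grad` has moments `0, 1, 1`. [folklore] -/
theorem witness_hypotheses :
    (∀ a ∈ ({pt (-2), pt (-1), pt 0, pt 1, pt 2, pt 3} : Finset (Fin 1 → ℤ)),
        (∑ u ∈ S₃, χ₂ (a - u) • blockConst u = 1) ∧ (∑ x ∈ S₃, χ₂ (x - a) • blockConst x = 1)
        ∧ (∑ u ∈ S₃, χ₂ (a - u) • hat u = 2) ∧ (∑ u ∈ S₃, (χ₂ (a - u) * u 0) • hat u = 0)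
        ∧ (∑ x ∈ S₃, χ₂ (x - a) • hat x = 2))
    ∧ (∑ u ∈ S₃, (χ₂ (pt 1 - u) * u 0) • blockConst u = 1) ∧ (∑ u ∈ S₃, (χ₂ (pt 0 - u) * u 0) • blockConst u = 0)
    ∧ fmom S₃ (fun _ => 1) lap = 0 ∧ fmom S₃ (fun t => t 0) lap = 0 ∧ fmom S₃ (fun t => t 0 * t 0) lap = 2
    ∧ fmom S₃ (fun _ => 1) grad = 0 ∧ fmom S₃ (fun t => t 0) grad = 1 := by
  decide

/-- **WITNESS 1 — (L1) is necessary.**  Left = right = block-constant injection ((L0), (R0) with `σ = σ' = 1`; (L1)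
fails: the windowed first moments are `1` on odd and `0` on even cosets), `T = lap` ((T0), (T1) hold): the windowed
second moment is `8`, not `σ · M2(T) · M0(w') = 1 · 2 · 2 = 4`. [folklore] -/
theorem witness_L1_needed :
    wsum χ₂ S₃ S₃ S₃ blockConst lap blockConst (fun u t x => (t + x - u) 0 * (t + x - u) 0) = 8
    ∧ (1 : ℤ) * fmom S₃ (fun t => t 0 * t 0) lap * fmom S₃ (fun _ => 1) blockConst = 4 := by
  decide

/-- **WITNESS 2 — (T1) is necessary in the two-sided setting.**  Left = hat ((L0) with `σ = 2`, (L1) with `C = 0`),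
right = block-constant ((R0) with `σ' = 1`), `T = grad` ((T0) holds, (T1) fails): the windowed second moment is `8`,
not `σ · M2(T) · M0(w') = 2 · 1 · 2 = 4` — the difference is the master identity's `2 σ · M1(T) · M1(w') = 4`.
[folklore] -/
theorem witness_T1_needed :
    wsum χ₂ S₃ S₃ S₃ hat grad blockConst (fun u t x => (t + x - u) 0 * (t + x - u) 0) = 8
    ∧ (2 : ℤ) * fmom S₃ (fun t => t 0 * t 0) grad * fmom S₃ (fun _ => 1) blockConst = 4 := by
  decide

/-- **EXAMPLE — a positive instance.**  Left = right = hat, `T = lap`: windowed second moment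
`16 = σ · M2(T) · M0(w') = 2 · 2 · 4`, as `wsum_second_of_vanishing` predicts. [folklore] -/
theorem example_identity :
    wsum χ₂ S₃ S₃ S₃ hat lap hat (fun u t x => (t + x - u) 0 * (t + x - u) 0) = 16
    ∧ (2 : ℤ) * fmom S₃ (fun t => t 0 * t 0) lap * fmom S₃ (fun _ => 1) hat = 16 := by
  decide

end Witness

/-! ## §5 Dictionary to `Beta/MomentFactorisation` -/

section Dictionary

open MomentFactorisation

/-- The `Finsupp` moments of `Beta/MomentFactorisation` are the finite moments of this file over the support.
[folklore] -/
theorem moment_eq_fmom (φ : (Fin d → ℤ) → ℤ) (f : LatFun d R) : moment φ f = fmom f.support φ ⇑f := rfl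

/-- `M0 f = fmom f.support 1 f`. [folklore] -/
theorem M0_eq_fmom (f : LatFun d R) : M0 f = fmom f.support (fun _ => 1) ⇑f := rfl

/-- `M1_μ f = fmom f.support (·_μ) f`. [folklore] -/
theorem M1_eq_fmom (μ : Fin d) (f : LatFun d R) : M1 μ f = fmom f.support (fun x => x μ) ⇑f := rfl

/-- `M2_{μν} f = fmom f.support (·_μ ·_ν) f`. [folklore] -/
theorem M2_eq_fmom (μ ν : Fin d) (f : LatFun d R) : M2 μ ν f = fmom f.support (fun x => x μ * x ν) ⇑f := rfl

/-- Triple-convolution moments as a triple `Finsupp.sum`. [folklore] -/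
theorem moment_conv3 (ψ : (Fin d → ℤ) → ℤ) (f T g : LatFun d R) :
    moment ψ (conv (conv f T) g)
      = f.sum fun a α => T.sum fun t β => g.sum fun x γ => ψ (a + t + x) • (α * β * γ) := by
  rw [moment_conv]
  have h0 : ∀ z : Fin d → ℤ, (g.sum fun x γ => ψ (z + x) • ((0 : R) * γ)) = 0 := by
    intro z; simp only [zero_mul, smul_zero, Finsupp.sum_fun_zero]
  have hadd : ∀ (z : Fin d → ℤ) (c₁ c₂ : R),
      (g.sum fun x γ => ψ (z + x) • ((c₁ + c₂) * γ))
        = (g.sum fun x γ => ψ (z + x) • (c₁ * γ)) + g.sum fun x γ => ψ (z + x) • (c₂ * γ) := by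
    intro z c₁ c₂; simp only [add_mul, smul_add, Finsupp.sum_add]
  unfold conv
  rw [Finsupp.sum_sum_index h0 hadd]
  apply Finsupp.sum_congr
  intro a _
  rw [Finsupp.sum_sum_index h0 hadd]
  apply Finsupp.sum_congr
  intro t _
  rw [Finsupp.sum_single_index (h0 _)]

/-- The windowed/weighted moments of the two-sided dressed kernel `reflect w ⋆ T ⋆ w'` of `Beta/MomentFactorisation`
ARE the `wsum`s of this file (sums over the supports; the coarse point is `t + x − u`). [folklore] -/
theorem moment_dressed_eq_sum (ψ : (Fin d → ℤ) → ℤ) (w T w' : LatFun d R) :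
    moment ψ (conv (conv (reflect w) T) w')
      = ∑ u ∈ w.support, ∑ t ∈ T.support, ∑ x ∈ w'.support, ψ (t + x - u) • (w u * T t * w' x) := by
  rw [moment_conv3, reflect]
  have h0 : ∀ a : Fin d → ℤ,
      (T.sum fun t β => w'.sum fun x γ => ψ (a + t + x) • ((0 : R) * β * γ)) = 0 := by
    intro a; simp only [zero_mul, smul_zero, Finsupp.sum_fun_zero]
  have hadd : ∀ (a : Fin d → ℤ) (c₁ c₂ : R),
      (T.sum fun t β => w'.sum fun x γ => ψ (a + t + x) • ((c₁ + c₂) * β * γ))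
        = (T.sum fun t β => w'.sum fun x γ => ψ (a + t + x) • (c₁ * β * γ))
          + T.sum fun t β => w'.sum fun x γ => ψ (a + t + x) • (c₂ * β * γ) := by
    intro a c₁ c₂; simp only [add_mul, smul_add, Finsupp.sum_add]
  rw [Finsupp.sum_mapDomain_index h0 hadd]
  simp only [Finsupp.sum]
  refine Finset.sum_congr rfl fun u _ => Finset.sum_congr rfl fun t _ => Finset.sum_congr rfl fun x _ => ?_
  rw [show -u + t + x = t + x - u by abel]

/-- In particular `wsum χ … (fun u t x => φ (t+x−u))` is the `χ·φ`-moment of `reflect w ⋆ T ⋆ w'`. [folklore] -/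
theorem wsum_eq_moment (χ φ : (Fin d → ℤ) → ℤ) (w T w' : LatFun d R) :
    wsum χ w.support T.support w'.support ⇑w ⇑T ⇑w' (fun u t x => φ (t + x - u))
      = moment (fun y => χ y * φ y) (conv (conv (reflect w) T) w') := by
  rw [moment_dressed_eq_sum]; rfl

/-- **THE IDENTITY in `MomentFactorisation` vocabulary**: for `w T w' : LatFun d R` with (L0), (L1) over `w.support`,
(R0) over `w'.support`, and `M0 T = 0`, `M1_κ T = 0`, `M1_λ T = 0`, the windowed second moment of the two-sided
dressed kernel (sums over the supports) is `σ · M2_{κλ} T · M0 w'`. [folklore] -/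
theorem wsum_second_of_vanishing' (χ : (Fin d → ℤ) → ℤ) (w T w' : LatFun d R) {σ σ' : R} {C : Fin d → R}
    (hL0 : ∀ a, ∑ u ∈ w.support, χ (a - u) • w u = σ)
    (hL1 : ∀ a κ, ∑ u ∈ w.support, (χ (a - u) * u κ) • w u = C κ)
    (hR0 : ∀ a, ∑ x ∈ w'.support, χ (x - a) • w' x = σ') (κ l : Fin d)
    (hT0 : M0 T = 0) (hT1κ : M1 κ T = 0) (hT1l : M1 l T = 0) :
    wsum χ w.support T.support w'.support ⇑w ⇑T ⇑w' (fun u t x => (t + x - u) κ * (t + x - u) l)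
      = σ * M2 κ l T * M0 w' := by
  rw [M2_eq_fmom, M0_eq_fmom]
  exact wsum_second_of_vanishing χ w.support T.support w'.support ⇑w ⇑T ⇑w' hL0 hL1 hR0 κ l hT0 hT1κ hT1l

/-- **THE IDENTITY for the cell's dressed kernels**: under (L0), (L1), (R0) (sums over the supports, any window `χ`)
and `M0 T = 0`, `M1_κ T = M1_λ T = 0`, the `χ`-windowed second moment of `reflect w ⋆ T ⋆ w'` is `σ · M2_{κλ} T · M0 w'`;
with `χ` the indicator of `L•ℤ^d` this is the DECIMATED second moment (B12-XREAD-V22 §3; `Beta/StrangFixMoment` for the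
scalar same-weight case). [folklore] -/
theorem windowed_second_moment_dressed (χ : (Fin d → ℤ) → ℤ) (w T w' : LatFun d R) {σ σ' : R} {C : Fin d → R}
    (hL0 : ∀ a, ∑ u ∈ w.support, χ (a - u) • w u = σ)
    (hL1 : ∀ a κ, ∑ u ∈ w.support, (χ (a - u) * u κ) • w u = C κ)
    (hR0 : ∀ a, ∑ x ∈ w'.support, χ (x - a) • w' x = σ') (κ l : Fin d)
    (hT0 : M0 T = 0) (hT1κ : M1 κ T = 0) (hT1l : M1 l T = 0) :
    moment (fun y => χ y * (y κ * y l)) (conv (conv (reflect w) T) w') = σ * M2 κ l T * M0 w' := by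
  rw [← wsum_eq_moment χ (fun y => y κ * y l) w T w']
  exact wsum_second_of_vanishing' χ w T w' hL0 hL1 hR0 κ l hT0 hT1κ hT1l

/-- … and its windowed zeroth and first moments VANISH (the coarse kernel again satisfies (T0), (T1)). [folklore] -/
theorem windowed_low_moments_dressed (χ : (Fin d → ℤ) → ℤ) (w T w' : LatFun d R) {σ : R} {C : Fin d → R}
    (hL0 : ∀ a, ∑ u ∈ w.support, χ (a - u) • w u = σ)
    (hL1 : ∀ a κ, ∑ u ∈ w.support, (χ (a - u) * u κ) • w u = C κ) (κ : Fin d)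
    (hT0 : M0 T = 0) (hT1 : M1 κ T = 0) :
    moment (fun y => χ y * 1) (conv (conv (reflect w) T) w') = 0
    ∧ moment (fun y => χ y * y κ) (conv (conv (reflect w) T) w') = 0 := by
  refine ⟨?_, ?_⟩
  · rw [← wsum_eq_moment χ (fun _ => 1) w T w']
    exact wsum_zero_of_vanishing χ w.support T.support w'.support ⇑w ⇑T ⇑w' hL0 hT0
  · rw [← wsum_eq_moment χ (fun y => y κ) w T w']
    exact wsum_first_of_vanishing χ w.support T.support w'.support ⇑w ⇑T ⇑w' hL0 hL1 κ hT0 hT1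

end Dictionary

/-! ## §6 The low-moment hypotheses (T0), (T1) from position-space symmetries of the kernel

[folklore] finite moment algebra.  CONTEXT (locators only, nothing of the paper is asserted): in
[Balaban1987RG1] §5 the one-loop vacuum-polarization kernel `Π_{μν}(x − y)` (p.292 (5.1), (5.5); p.293 (5.8)
«translation invariant and symmetric») is stated to obey (p.293, line after (5.6), and (5.7)) the reflection
covariance `Π_{μν}(εx − ((1−ε_μ)/2)e_μ, εy − ((1−ε_ν)/2)e_ν) = ε_μ ε_ν Π_{μν}(x, y)` — for the full inversion
`ε ≡ −1` and with (5.8): `Π_{μν}(−z + e_ν − e_μ) = Π_{μν}(z)` (the kernel is even about the bond-midpoint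
offset) — and (p.293 (5.9), «the gauge invariance, expressed in the first identity (4.15), implies»)
`Σ_μ ∂*_μ Π_{μν}(x − y) = 0`.  Below: for ANY finitely supported family `K μ ν : LatFun d R` (the cell's
truncated typing; the decaying infinite-volume kernel is the `T ↗ ℤ⁴` road, not treated here),
divergence-freeness in the first index forces ALL zeroth moments to vanish (`M0_eq_zero_of_divFree`) and
midpoint-inversion evenness plus `M0 = 0` forces `M1 + M1 = 0` (`M1_add_self_eq_zero_of_inversion`), i.e.
`M1 = 0` without 2-torsion: exactly the hypotheses (T0), (T1) of §3/§5, entrywise. -/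

section Symmetries

open MomentFactorisation

variable {d : ℕ} {R : Type*} [Ring R]

/-- Relabelling of the lattice argument: `relabel g f = Finsupp.mapDomain g f` (for an injective `g`,
`(relabel g f) (g z) = f z`). [folklore] -/
noncomputable def relabel (g : (Fin d → ℤ) → (Fin d → ℤ)) (f : LatFun d R) : LatFun d R :=
  Finsupp.mapDomain g f

/-- The lattice unit vector `e_μ`. [folklore] -/
def unitVec (μ : Fin d) : Fin d → ℤ := Pi.single μ 1

/-- Moments of a relabelled function: the weight is composed with the relabelling. [folklore] -/
theorem moment_relabel (φ : (Fin d → ℤ) → ℤ) (g : (Fin d → ℤ) → (Fin d → ℤ)) (f : LatFun d R) :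
    moment φ (relabel g f) = moment (fun z => φ (g z)) f := by
  unfold moment relabel
  exact Finsupp.sum_mapDomain_index (fun _ => smul_zero _) (fun _ _ _ => smul_add _ _ _)

/-- Relabelling preserves the zeroth moment. [folklore] -/
theorem M0_relabel (g : (Fin d → ℤ) → (Fin d → ℤ)) (f : LatFun d R) : M0 (relabel g f) = M0 f := by
  unfold M0; rw [moment_relabel]

/-- A constant weight gives a multiple of the zeroth moment. [folklore] -/
theorem moment_const (c : ℤ) (f : LatFun d R) : moment (fun _ => c) f = c • M0 f := by
  simp only [moment, M0, Finsupp.smul_sum, smul_smul, mul_one]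

/-- First moments of the SHIFT `z ↦ f (z − c)` (= `relabel (· + c) f`): `M1_κ = M1_κ f + c_κ • M0 f`. [folklore] -/
theorem M1_shift (c : Fin d → ℤ) (κ : Fin d) (f : LatFun d R) :
    M1 κ (relabel (fun z => z + c) f) = M1 κ f + c κ • M0 f := by
  unfold M1; rw [moment_relabel]
  have h := moment_add_weight (fun x : Fin d → ℤ => x κ) (fun _ => c κ) f
  simp only [Pi.add_apply]
  rw [h, moment_const]

/-- First moments of the MIDPOINT INVERSION `z ↦ f (c − z)` (= `relabel (c − ·) f`, an involution):
`M1_κ = −M1_κ f + c_κ • M0 f`. [folklore] -/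
theorem M1_invert (c : Fin d → ℤ) (κ : Fin d) (f : LatFun d R) :
    M1 κ (relabel (fun z => -z + c) f) = -M1 κ f + c κ • M0 f := by
  unfold M1; rw [moment_relabel]
  have h := moment_add_weight (fun x : Fin d → ℤ => -x κ) (fun _ => c κ) f
  have hneg : moment (fun x : Fin d → ℤ => -x κ) f = -moment (fun x => x κ) f := by
    simp only [moment, neg_smul, Finsupp.sum_neg]
  simp only [Pi.add_apply, Pi.neg_apply]
  rw [h, hneg, moment_const]

/-- Moments of a finite sum of lattice functions. [folklore] -/
theorem moment_finset_sum {ι : Type*} (φ : (Fin d → ℤ) → ℤ) (s : Finset ι) (F : ι → LatFun d R) :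
    moment φ (∑ i ∈ s, F i) = ∑ i ∈ s, moment φ (F i) := by
  unfold moment
  exact (Finsupp.sum_finsetSum_index (fun _ => smul_zero _) (fun _ _ _ => smul_add _ _ _)).symm

/-- **(T0) from divergence-freeness.**  If a finitely supported family of kernels `K μ ν` is divergence-free
in the first index in the backward sense, `Σ_μ (Π_{μν}(z) − Π_{μν}(z − e_μ)) = 0` for all `z` (as an identity
of lattice functions), then EVERY zeroth moment vanishes: `M0 (K κ ν) = 0`.  (Proof: take the `κ`-th first
moment of the identity; the shift contributes `−(e_μ)_κ • M0 (K μ ν)`.) [folklore] -/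
theorem M0_eq_zero_of_divFree (K : Fin d → Fin d → LatFun d R)
    (hdiv : ∀ ν, ∑ μ, (K μ ν - relabel (fun z => z + unitVec μ) (K μ ν)) = 0) (κ ν : Fin d) :
    M0 (K κ ν) = 0 := by
  have h := congrArg (M1 κ) (hdiv ν)
  have hz : M1 κ (0 : LatFun d R) = 0 := moment_zero _
  rw [hz, M1, moment_finset_sum] at h
  have hterm : ∀ μ, moment (fun x : Fin d → ℤ => x κ) (K μ ν - relabel (fun z => z + unitVec μ) (K μ ν))
      = -(unitVec μ κ • M0 (K μ ν)) := by
    intro μ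
    rw [moment_sub]
    have := M1_shift (unitVec μ) κ (K μ ν)
    unfold M1 at this
    rw [this]; abel
  simp only [hterm, Finset.sum_neg_distrib, neg_eq_zero] at h
  have hsum : ∑ μ, unitVec μ κ • M0 (K μ ν) = M0 (K κ ν) := by
    simp only [unitVec, Pi.single_apply, ite_smul, one_smul, zero_smul, Finset.sum_ite_eq,
      Finset.mem_univ, if_true]
  rw [← hsum]; exact h

/-- **(T1) from midpoint-inversion evenness.**  If `f (c − z) = f z` (as lattice functions: `relabel (c − ·) f = f`)
and `M0 f = 0`, then `M1_κ f + M1_κ f = 0` for every `κ`. [folklore] -/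
theorem M1_add_self_eq_zero_of_inversion (f : LatFun d R) (c : Fin d → ℤ)
    (hinv : relabel (fun z => -z + c) f = f) (h0 : M0 f = 0) (κ : Fin d) : M1 κ f + M1 κ f = 0 := by
  have h := M1_invert c κ f
  rw [hinv, h0, smul_zero, add_zero, eq_neg_iff_add_eq_zero] at h
  exact h

/-- … hence `M1_κ f = 0` in a ring without 2-torsion. [folklore] -/
theorem M1_eq_zero_of_inversion (f : LatFun d R) (c : Fin d → ℤ) (htors : ∀ a : R, a + a = 0 → a = 0)
    (hinv : relabel (fun z => -z + c) f = f) (h0 : M0 f = 0) (κ : Fin d) : M1 κ f = 0 :=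
  htors _ (M1_add_self_eq_zero_of_inversion f c hinv h0 κ)

/-- **(T0) ∧ (T1) for a kernel family with the two position-space symmetries** (no 2-torsion):
divergence-free in the first index (backward differences) and even about the midpoint offset `e_ν − e_μ`
⟹ all zeroth AND all first moments of every entry `K μ ν` vanish — the entrywise hypotheses `hT0`, `hT1κ`,
`hT1l` of `windowed_second_moment_dressed` / `wsum_second_of_vanishing`. [folklore] -/
theorem low_moments_of_symmetries (K : Fin d → Fin d → LatFun d R) (htors : ∀ a : R, a + a = 0 → a = 0)
    (hdiv : ∀ ν, ∑ μ, (K μ ν - relabel (fun z => z + unitVec μ) (K μ ν)) = 0)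
    (hinv : ∀ μ ν, relabel (fun z => -z + (unitVec ν - unitVec μ)) (K μ ν) = K μ ν) :
    (∀ μ ν, M0 (K μ ν) = 0) ∧ (∀ κ μ ν, M1 κ (K μ ν) = 0) := by
  have h0 : ∀ μ ν, M0 (K μ ν) = 0 := fun μ ν => M0_eq_zero_of_divFree K hdiv μ ν
  exact ⟨h0, fun κ μ ν => M1_eq_zero_of_inversion (K μ ν) _ htors (hinv μ ν) (h0 μ ν) κ⟩

end Symmetries

/-! ## §7 (v1.2) Composition of affine-reproducing patterns — the one-step hypotheses iterate -/

section Composition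

open MomentFactorisation

variable {d : ℕ} {R : Type*} [Ring R]

/-- The indicator of the sublattice `N•ℤ^d`, as an integer window. [folklore] -/
def cosetInd (N : ℕ) (z : Fin d → ℤ) : ℤ := if ∀ i, (N : ℤ) ∣ z i then 1 else 0

/-- Dilation of a finitely supported lattice function by the integer factor `N`: mass `f y` moved to `N • y`. [folklore] -/
noncomputable def dilate (N : ℕ) (f : LatFun d R) : LatFun d R := relabel (fun z => (N : ℤ) • z) f

/-- (L0) for the sublattice window `N•ℤ^d`: every coset sum `Σ_{u ≡ a (N)} w u` equals `σ`
(the translation-covariant map with pattern `w` reproduces CONSTANTS, with mass `σ`). [folklore] -/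
def ConstRepro (N : ℕ) (w : LatFun d R) (σ : R) : Prop :=
  ∀ a, moment (fun u => cosetInd N (a - u)) w = σ

/-- (L1) for the sublattice window: every coset first moment `Σ_{u ≡ a (N)} u_κ • w u` equals `C κ`
(together with (L0): the map reproduces AFFINE functions). [folklore] -/
def LinRepro (N : ℕ) (w : LatFun d R) (C : Fin d → R) : Prop :=
  ∀ a κ, moment (fun u => cosetInd N (a - u) * u κ) w = C κ

/-- `cosetInd` is even. [folklore] -/
theorem cosetInd_neg (N : ℕ) (z : Fin d → ℤ) : cosetInd N (-z) = cosetInd N z := by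
  unfold cosetInd
  simp only [Pi.neg_apply, dvd_neg]

/-- `cosetInd N (x − a) = cosetInd N (a − x)` — so (R0) of §5 for the window `cosetInd N` is `ConstRepro`. [folklore] -/
theorem cosetInd_sub_comm (N : ℕ) (x a : Fin d → ℤ) : cosetInd N (x - a) = cosetInd N (a - x) := by
  rw [← cosetInd_neg N (x - a), neg_sub]

/-- The window `cosetInd 1` is identically `1`. [folklore] -/
theorem cosetInd_one (z : Fin d → ℤ) : cosetInd 1 z = 1 := by
  unfold cosetInd
  simp

/-- KEY ARITHMETIC STEP: on the dilated lattice `c − N₁•y`, the window of `N₁N₂•ℤ^d` factors as the window of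
`N₁•ℤ^d` at `c` times the window of `N₂•ℤ^d` at `c/N₁ − y`. [folklore] -/
theorem cosetInd_sub_dilate {N₁ : ℕ} (hN₁ : N₁ ≠ 0) (N₂ : ℕ) (c y : Fin d → ℤ) :
    cosetInd (N₁ * N₂) (c - (N₁ : ℤ) • y)
      = cosetInd N₁ c * cosetInd N₂ ((fun i => c i / (N₁ : ℤ)) - y) := by
  have hN₁' : (N₁ : ℤ) ≠ 0 := by exact_mod_cast hN₁
  unfold cosetInd
  by_cases h : ∀ i, (N₁ : ℤ) ∣ c i
  · rw [if_pos h, one_mul]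
    have key : ∀ i, ((N₁ * N₂ : ℕ) : ℤ) ∣ (c - (N₁ : ℤ) • y) i ↔ (N₂ : ℤ) ∣ ((fun i => c i / (N₁ : ℤ)) - y) i := by
      intro i
      have hc : c i = (N₁ : ℤ) * (c i / (N₁ : ℤ)) := (Int.mul_ediv_cancel' (h i)).symm
      have e : (c - (N₁ : ℤ) • y) i = (N₁ : ℤ) * (c i / (N₁ : ℤ) - y i) := by
        simp only [Pi.sub_apply, Pi.smul_apply, smul_eq_mul]
        rw [mul_sub, ← hc]
      rw [e, Nat.cast_mul, Pi.sub_apply]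
      exact mul_dvd_mul_iff_left hN₁'
    simp only [key]
  · rw [if_neg h, zero_mul, if_neg]
    intro hall
    apply h
    intro i
    have h1 : (N₁ : ℤ) ∣ (c - (N₁ : ℤ) • y) i :=
      dvd_trans (Dvd.intro _ (Nat.cast_mul N₁ N₂).symm) (hall i)
    have h2 : (c - (N₁ : ℤ) • y) i + (N₁ : ℤ) * y i = c i := by
      simp only [Pi.sub_apply, Pi.smul_apply, smul_eq_mul, sub_add_cancel]
    rw [← h2]
    exact dvd_add h1 (dvd_mul_right _ _)

/-- Pull a constant LEFT ring factor out of an integer-weighted sum. [folklore] -/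
theorem sum_smul_mul_left (w : LatFun d R) (φ : (Fin d → ℤ) → ℤ) (r : R) :
    (w.sum fun y b => φ y • (r * b)) = r * (w.sum fun y b => φ y • b) := by
  rw [Finsupp.mul_sum]
  exact Finsupp.sum_congr fun y _ => (mul_smul_comm (φ y) r _).symm

/-- Moments of a convolution with a DILATED pattern, as a double sum over the undilated supports. [folklore] -/
theorem moment_conv_dilate (φ : (Fin d → ℤ) → ℤ) (N : ℕ) (w₁ w₂ : LatFun d R) :
    moment φ (conv w₁ (dilate N w₂))
      = w₁.sum fun x a => w₂.sum fun y b => φ (x + (N : ℤ) • y) • (a * b) := by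
  rw [moment_conv]
  apply Finsupp.sum_congr
  intro x _
  unfold dilate relabel
  exact Finsupp.sum_mapDomain_index (fun _ => by rw [mul_zero, smul_zero]) (fun _ _ _ => by rw [mul_add, smul_add])

/-- Inner coset sum, constants: `Σ_y 1_{N₁N₂ℤ^d}(c − N₁y) • (r · w₂ y) = 1_{N₁ℤ^d}(c) • (r · σ₂)`. [folklore] -/
theorem inner_const {N₁ : ℕ} (hN₁ : N₁ ≠ 0) {N₂ : ℕ} {w₂ : LatFun d R} {σ₂ : R} (h2 : ConstRepro N₂ w₂ σ₂)
    (c : Fin d → ℤ) (r : R) :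
    (w₂.sum fun y b => cosetInd (N₁ * N₂) (c - (N₁ : ℤ) • y) • (r * b)) = cosetInd N₁ c • (r * σ₂) := by
  simp_rw [cosetInd_sub_dilate hN₁ N₂ c, mul_smul]
  rw [← Finsupp.smul_sum, sum_smul_mul_left]
  congr 2
  exact h2 (fun i => c i / (N₁ : ℤ))

/-- Inner coset sum, coordinate functions. [folklore] -/
theorem inner_lin {N₁ : ℕ} (hN₁ : N₁ ≠ 0) {N₂ : ℕ} {w₂ : LatFun d R} {σ₂ : R} {C₂ : Fin d → R}
    (h2 : ConstRepro N₂ w₂ σ₂) (h2' : LinRepro N₂ w₂ C₂) (c x : Fin d → ℤ) (κ : Fin d) (r : R) :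
    (w₂.sum fun y b => (cosetInd (N₁ * N₂) (c - (N₁ : ℤ) • y) * (x κ + (N₁ : ℤ) * y κ)) • (r * b))
      = cosetInd N₁ c • (x κ • (r * σ₂) + (N₁ : ℤ) • (r * C₂ κ)) := by
  set c' : Fin d → ℤ := fun i => c i / (N₁ : ℤ) with hc'
  have hpt : ∀ (y : Fin d → ℤ) (b : R),
      (cosetInd (N₁ * N₂) (c - (N₁ : ℤ) • y) * (x κ + (N₁ : ℤ) * y κ)) • (r * b)
        = cosetInd N₁ c • (x κ • (cosetInd N₂ (c' - y) • (r * b)))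
          + cosetInd N₁ c • ((N₁ : ℤ) • ((cosetInd N₂ (c' - y) * y κ) • (r * b))) := by
    intro y b
    rw [cosetInd_sub_dilate hN₁ N₂ c y]
    rw [show cosetInd N₁ c * cosetInd N₂ (c' - y) * (x κ + (N₁ : ℤ) * y κ)
        = cosetInd N₁ c * (x κ * cosetInd N₂ (c' - y)) + cosetInd N₁ c * ((N₁ : ℤ) * (cosetInd N₂ (c' - y) * y κ))
        by ring]
    rw [add_smul, mul_smul, mul_smul, mul_smul, mul_smul]
  simp_rw [hpt]
  rw [Finsupp.sum_add, ← Finsupp.smul_sum, ← Finsupp.smul_sum, ← Finsupp.smul_sum, ← Finsupp.smul_sum,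
    sum_smul_mul_left, sum_smul_mul_left, ← smul_add]
  congr 1
  have e0 : (w₂.sum fun y b => cosetInd N₂ (c' - y) • b) = σ₂ := h2 c'
  have e1 : (w₂.sum fun y b => (cosetInd N₂ (c' - y) * y κ) • b) = C₂ κ := h2' c' κ
  rw [e0, e1]

/-- **COMPOSITION, constants.**  If `w₁` reproduces constants for the window `N₁•ℤ^d` (mass `σ₁`) and `w₂` for
`N₂•ℤ^d` (mass `σ₂`), the composite pattern `w₁ ⋆ dilate N₁ w₂` (= the pattern of the composite covariant map
fine ← mid ← coarse) reproduces constants for the window `N₁N₂•ℤ^d` with mass `σ₁ σ₂`. [folklore] -/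
theorem constRepro_comp {N₁ N₂ : ℕ} (hN₁ : N₁ ≠ 0) {w₁ w₂ : LatFun d R} {σ₁ σ₂ : R}
    (h1 : ConstRepro N₁ w₁ σ₁) (h2 : ConstRepro N₂ w₂ σ₂) :
    ConstRepro (N₁ * N₂) (conv w₁ (dilate N₁ w₂)) (σ₁ * σ₂) := by
  intro a
  rw [moment_conv_dilate]
  have step : ∀ (x : Fin d → ℤ) (r : R),
      (w₂.sum fun y b => cosetInd (N₁ * N₂) (a - (x + (N₁ : ℤ) • y)) • (r * b))
        = cosetInd N₁ (a - x) • (r * σ₂) := by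
    intro x r
    have : ∀ y : Fin d → ℤ, a - (x + (N₁ : ℤ) • y) = (a - x) - (N₁ : ℤ) • y := fun y => by abel
    simp_rw [this]
    exact inner_const hN₁ h2 (a - x) r
  simp_rw [step, ← smul_mul_assoc]
  rw [← Finsupp.sum_mul]
  congr 1
  exact h1 a

/-- **COMPOSITION, affine functions.**  With (L0) and (L1) for both factors, the composite pattern satisfies (L1)
for the window `N₁N₂•ℤ^d` with constants `C κ = C₁ κ · σ₂ + N₁ • (σ₁ · C₂ κ)` (order of factors as written;
`σ`, `C` possibly non-central). [folklore] -/
theorem linRepro_comp {N₁ N₂ : ℕ} (hN₁ : N₁ ≠ 0) {w₁ w₂ : LatFun d R} {σ₁ σ₂ : R} {C₁ C₂ : Fin d → R}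
    (h1 : ConstRepro N₁ w₁ σ₁) (h1' : LinRepro N₁ w₁ C₁) (h2 : ConstRepro N₂ w₂ σ₂) (h2' : LinRepro N₂ w₂ C₂) :
    LinRepro (N₁ * N₂) (conv w₁ (dilate N₁ w₂)) (fun κ => C₁ κ * σ₂ + (N₁ : ℤ) • (σ₁ * C₂ κ)) := by
  intro a κ
  rw [moment_conv_dilate]
  have step : ∀ (x : Fin d → ℤ) (r : R),
      (w₂.sum fun y b => (cosetInd (N₁ * N₂) (a - (x + (N₁ : ℤ) • y)) * (x + (N₁ : ℤ) • y) κ) • (r * b))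
        = (cosetInd N₁ (a - x) * x κ) • (r * σ₂) + cosetInd N₁ (a - x) • ((N₁ : ℤ) • (r * C₂ κ)) := by
    intro x r
    have e1 : ∀ y : Fin d → ℤ, a - (x + (N₁ : ℤ) • y) = (a - x) - (N₁ : ℤ) • y := fun y => by abel
    have e2 : ∀ y : Fin d → ℤ, (x + (N₁ : ℤ) • y) κ = x κ + (N₁ : ℤ) * y κ := fun y => by
      simp only [Pi.add_apply, Pi.smul_apply, smul_eq_mul]
    simp_rw [e1, e2]
    rw [inner_lin hN₁ h2 h2' (a - x) x κ r, smul_add, mul_smul]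
  simp_rw [step]
  rw [Finsupp.sum_add]
  have t1 : (w₁.sum fun x r => (cosetInd N₁ (a - x) * x κ) • (r * σ₂)) = C₁ κ * σ₂ := by
    simp_rw [← smul_mul_assoc]
    rw [← Finsupp.sum_mul]
    congr 1
    exact h1' a κ
  have t2 : (w₁.sum fun x r => cosetInd N₁ (a - x) • ((N₁ : ℤ) • (r * C₂ κ)))
      = (N₁ : ℤ) • (σ₁ * C₂ κ) := by
    simp_rw [smul_comm (cosetInd N₁ (a - _)) (N₁ : ℤ) _, ← smul_mul_assoc]
    rw [← Finsupp.sum_mul, ← Finsupp.smul_sum]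
    congr 2
    exact h1 a
  rw [t1, t2]

/-- The unit pattern `δ₀` reproduces everything for the trivial window (`N = 1`). [folklore] -/
theorem constRepro_single_zero : ConstRepro 1 (Finsupp.single (0 : Fin d → ℤ) (1 : R)) 1 := by
  intro a
  rw [moment_single, cosetInd_one, one_smul]

/-- … with first-moment constants `0`. [folklore] -/
theorem linRepro_single_zero : LinRepro 1 (Finsupp.single (0 : Fin d → ℤ) (1 : R)) (fun _ => 0) := by
  intro a κ
  rw [moment_single, cosetInd_one, Pi.zero_apply, mul_zero, zero_smul]

/-- The pattern of the `m`-fold composite of a one-step covariant map with pattern `w` and integer ratio `L`: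
`iterPattern L w 0 = δ₀`, `iterPattern L w (m+1) = w ⋆ dilate L (iterPattern L w m)`. [folklore] -/
noncomputable def iterPattern (L : ℕ) (w : LatFun d R) : ℕ → LatFun d R
  | 0 => Finsupp.single 0 1
  | m + 1 => conv w (dilate L (iterPattern L w m))

/-- The first-moment constants of the `m`-fold composite: `iterC 0 = 0`,
`iterC (m+1) κ = C κ · σ^m + L • (σ · iterC m κ)`. [folklore] -/
def iterC (L : ℕ) (σ : R) (C : Fin d → R) : ℕ → Fin d → R
  | 0 => fun _ => 0
  | m + 1 => fun κ => C κ * σ ^ m + (L : ℤ) • (σ * iterC L σ C m κ)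

/-- **ITERATION.**  A one-step pattern reproducing constants (mass `σ`, window `L•ℤ^d`, `L ≠ 0`) has `m`-fold
composites reproducing constants with mass `σ^m` for the window `L^m•ℤ^d`. [folklore] -/
theorem constRepro_iter {L : ℕ} (hL : L ≠ 0) {w : LatFun d R} {σ : R} (h : ConstRepro L w σ) :
    ∀ m, ConstRepro (L ^ m) (iterPattern L w m) (σ ^ m)
  | 0 => by
    rw [pow_zero, pow_zero]
    exact constRepro_single_zero
  | m + 1 => by
    rw [pow_succ, pow_succ', mul_comm (L ^ m) L]
    exact constRepro_comp hL h (constRepro_iter hL h m)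

/-- **ITERATION, affine.**  … and reproducing affine functions, with the constants `iterC L σ C m`. [folklore] -/
theorem linRepro_iter {L : ℕ} (hL : L ≠ 0) {w : LatFun d R} {σ : R} {C : Fin d → R}
    (h : ConstRepro L w σ) (h' : LinRepro L w C) :
    ∀ m, LinRepro (L ^ m) (iterPattern L w m) (iterC L σ C m)
  | 0 => by
    rw [pow_zero]
    exact linRepro_single_zero
  | m + 1 => by
    rw [pow_succ, mul_comm (L ^ m) L]
    exact linRepro_comp hL h h' (constRepro_iter hL h m) (linRepro_iter hL h h' m)

/-- BRIDGE to §5: `ConstRepro` / `LinRepro` are literally the hypotheses (L0) / (L1) of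
`windowed_second_moment_dressed` for the window `χ = cosetInd N`, and (R0) is `ConstRepro` of the right pattern
(the window is even). [folklore] -/
theorem constRepro_iff (N : ℕ) (w : LatFun d R) (σ : R) :
    ConstRepro N w σ ↔ ∀ a, ∑ u ∈ w.support, cosetInd N (a - u) • w u = σ := Iff.rfl

/-- (L1) in the §5 form. [folklore] -/
theorem linRepro_iff (N : ℕ) (w : LatFun d R) (C : Fin d → R) :
    LinRepro N w C ↔ ∀ a κ, ∑ u ∈ w.support, (cosetInd N (a - u) * u κ) • w u = C κ := Iff.rfl

/-- (R0) in the §5 form. [folklore] -/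
theorem constRepro_iff_right (N : ℕ) (w' : LatFun d R) (σ' : R) :
    ConstRepro N w' σ' ↔ ∀ a, ∑ x ∈ w'.support, cosetInd N (x - a) • w' x = σ' := by
  simp_rw [cosetInd_sub_comm N _ _]
  exact Iff.rfl

/-- **THE IDENTITY ALONG A COMPOSITION CHAIN.**  For the `m`-fold composite of a one-step covariant map whose
pattern `w` reproduces affine functions ((L0) mass `σ`, (L1) constants `C`, window `L•ℤ^d`), dressing a kernel `T`
with (T0), (T1) on both sides and decimating to `L^m•ℤ^d` gives the second moment `σ^m · M2_{κλ}(T) · M0(w_m)`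
EXACTLY, `w_m = iterPattern L w m` — the one-step hypotheses suffice for every `m`. [folklore] -/
theorem windowed_second_moment_iter {L : ℕ} (hL : L ≠ 0) (w T : LatFun d R) {σ : R} {C : Fin d → R}
    (h : ConstRepro L w σ) (h' : LinRepro L w C) (m : ℕ) (κ l : Fin d)
    (hT0 : M0 T = 0) (hT1κ : M1 κ T = 0) (hT1l : M1 l T = 0) :
    moment (fun y => cosetInd (L ^ m) y * (y κ * y l))
        (conv (conv (reflect (iterPattern L w m)) T) (iterPattern L w m))
      = σ ^ m * M2 κ l T * M0 (iterPattern L w m) :=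
  windowed_second_moment_dressed (cosetInd (L ^ m)) (iterPattern L w m) T (iterPattern L w m)
    ((constRepro_iff _ _ _).1 (constRepro_iter hL h m))
    ((linRepro_iff _ _ _).1 (linRepro_iter hL h h' m))
    ((constRepro_iff_right _ _ _).1 (constRepro_iter hL h m)) κ l hT0 hT1κ hT1l

end Composition

end Literature.MathematicalPhysics.QuantumFieldTheory.Balaban1983to89.Beta.DecimatedMoment
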